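import Mathlib
import Summits.ValiantsHypothesis.ValiantsHypothesis.Theorems.LacunarySymmetroidMatrixDescartesOneSidedExact
import Summits.ValiantsHypothesis.ValiantsHypothesis.Theorems.LacunarySymmetroidMatrixDescartesTwoBlockDominance

/-!
# `MatrixDescartes` (stmt-ValiantsHypothesis-18050) — END INERTIAS OF A TWO-SIDED MONOTONE WORD: at small scales
# `ν(F(x)) = ν(B) + π(C₋₋)`, at large scales `ν(F(x)) = ν(B) − ν(C₊₊)`, both ends non-singular

HONEST FRAMING.  Cell `pub-symmetroid`, seat `val-sym-mdr-p2` (gen 21); helper file `--supports` the crux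
`Theses.LacunarySymmetroid.MatrixDescartes` (OPEN), NO closure claim; companion of `…TwoBlockDominance` (the two-block
dominance lemma), `…GramDualInertiaDuality` (`ν(F(x)) + #{σ>0} = ν(B) + π(𝔻(x))`), `…InertiaBand` (block form of the dual of
a juxtaposed word) and `…OneSidedExact` (the one-sided end computation).  STRUCTURE lemmas feeding THE EXACT MONOTONE COUNT
(`…MonotoneExact`, filed next); nothing here bears on the crux in its window, `stub_twoSided`, `DoorA26` / `DoorA34`,
registers, or `VP ≠ VNP`.

SETTING.  `B` real symmetric, `det B ≠ 0`, exponent `e`; positive columns `Uₚ` (`σₚ > 0`, exponents `δₚ > e`), negative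
columns `Uₙ` (`σₙ < 0`, exponents `δₙ < e`); `U = [Uₚ | Uₙ]`, Gram blocks `C₊₊ = UₚᵀB⁻¹Uₚ`, `C₊₋ = UₚᵀB⁻¹Uₙ`,
`C₋₋ = UₙᵀB⁻¹Uₙ`; dual `𝔻(x) = diag(σⱼ⁻¹x^{E−δⱼ}) + x^{E−e}·UᵀB⁻¹U`.

* `dual_fromCols_eq_smul_large` — for `x > 0`: `𝔻(x) = x^{E−e}·M(1/x)`, `M` the two-block family of `…TwoBlockDominance`
  on `(C₊₊, C₊₋, C₋₋; α = σₚ⁻¹, p = δₚ − e; β = −σₙ, q = e − δₙ)`.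
* `dual_fromCols_swap_eq_neg_smul_small` — for `x > 0`: `𝔻(x)` with its blocks SWAPPED equals `−x^{E−e}·M′(x)`, `M′` the
  family on `(−C₋₋, −C₋₊, −C₊₊; (−σₙ)⁻¹, e − δₙ; σₚ, δₚ − e)`.
* `exists_posIndex_dual_large` / `exists_posIndex_dual_small` — `π(𝔻(x)) + ν(C₊₊) = |ρₚ|` for `x ≥ N`,
  `π(𝔻(x)) = |ρₚ| + π(C₋₋)` for `x ∈ (0, ε)`, `det 𝔻(x) ≠ 0` at both ends (dominance lemma + transport of indices under
  positive scaling, negation and block swap).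
* **`exists_negIndex_word_large` / `exists_negIndex_word_small` (END INERTIAS OF THE WORD).**  `ν(F(x)) + ν(C₊₊) = ν(B)`
  for `x ≥ N` and `ν(F(x)) = ν(B) + π(C₋₋)` for `x ∈ (0, ε)`, with `det F(x) ≠ 0` there (duality + `#{σ > 0} = |ρₚ|` +
  the signed Gram determinant identity `det_base_mul_eq`).  The one-sided file's end values (`ν(B)` at `0⁺`,
  `ν(B) − ν(C)` at `∞`) are the case `ρₙ = ∅`.

[folklore] (Sylvester's law of inertia; Sylvester's determinant identity).  Axioms `propext`, `Classical.choice`,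
`Quot.sound`.  No definitions.
-/

-- layout Summits/ValiantsHypothesis/ValiantsHypothesis forces the duplicated namespace component
set_option linter.dupNamespace false

namespace Summit.ValiantsHypothesis.ValiantsHypothesis.Theorems.LacunarySymmetroidMatrixDescartes

open Polynomial Matrix Finset
open scoped BigOperators Topology

namespace GramDual

section MonotoneExact

variable {ι ρ ρₚ ρₙ : Type} [Fintype ι] [DecidableEq ι] [Fintype ρ] [DecidableEq ρ] [Fintype ρₚ] [DecidableEq ρₚ]
  [Fintype ρₙ] [DecidableEq ρₙ]

/-- the signed column part (file-local notation, as in `…GramDualSigned`) -/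
local notation3 (prettyPrint := false) "𝕊[" U ", " σ ", " δ "]" =>
  ((U : Matrix _ _ ℝ).map Polynomial.C
      * Matrix.diagonal (fun j => Polynomial.C ((σ : _ → ℝ) j) * (Polynomial.X : Polynomial ℝ) ^ (δ j : ℕ))
      * ((U : Matrix _ _ ℝ).map Polynomial.C)ᵀ)

/-- the two-block family of `…TwoBlockDominance` (file-local notation) -/
local notation3 (prettyPrint := false) "𝕄[" C₁₁ ", " C₁₂ ", " C₂₂ ", " α ", " p ", " β ", " q ", " s "]" =>
  Matrix.fromBlocks ((C₁₁ : Matrix _ _ ℝ) + Matrix.diagonal (fun j => (α : _ → ℝ) j * (s : ℝ) ^ ((p : _ → ℕ) j)))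
    (C₁₂ : Matrix _ _ ℝ) (C₁₂)ᵀ
    ((C₂₂ : Matrix _ _ ℝ) - Matrix.diagonal (fun j => ((β : _ → ℝ) j * (s : ℝ) ^ ((q : _ → ℕ) j))⁻¹))

/-! ## §1  The dual of a two-sided word at both ends, in two-block form -/

omit [Fintype ρ] in
/-- Lower columns at large scales: `diag(σ⁻¹x^{E−δ}) + x^{E−e}C = x^{E−e}·(C − diag((−σ·x⁻¹^{e−δ})⁻¹))`
(`δ < e ≤ E`). [folklore] -/
theorem lowerDual_eq_smul_large (C : Matrix ρ ρ ℝ) (σ : ρ → ℝ) (E e : ℕ) (δ : ρ → ℕ) (hδ : ∀ j, δ j < e)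
    (he : e ≤ E) (x : ℝ) :
    Matrix.diagonal (fun j => (σ j)⁻¹ * x ^ (E - δ j)) + x ^ (E - e) • C
      = x ^ (E - e) • (C - Matrix.diagonal (fun j => (-σ j * x⁻¹ ^ (e - δ j))⁻¹)) := by
  ext i j
  simp only [Matrix.add_apply, Matrix.smul_apply, Matrix.sub_apply, Matrix.diagonal_apply, smul_eq_mul]
  split_ifs with h
  · subst h
    have hk : E - δ i = (E - e) + (e - δ i) := by have := hδ i; omega
    rw [hk, pow_add, mul_inv, inv_pow, inv_inv, inv_neg]
    ring
  · ring

omit [Fintype ρ] in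
/-- Lower columns at small scales: `diag(σ⁻¹x^{E−δ}) + x^{E−e}C = −(x^{E−e}·(−C + diag((−σ)⁻¹x^{e−δ})))`
(`δ < e ≤ E`). [folklore] -/
theorem lowerDual_eq_neg_smul_small (C : Matrix ρ ρ ℝ) (σ : ρ → ℝ) (E e : ℕ) (δ : ρ → ℕ) (hδ : ∀ j, δ j < e)
    (he : e ≤ E) (x : ℝ) :
    Matrix.diagonal (fun j => (σ j)⁻¹ * x ^ (E - δ j)) + x ^ (E - e) • C
      = -(x ^ (E - e) • (-C + Matrix.diagonal (fun j => (-σ j)⁻¹ * x ^ (e - δ j)))) := by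
  ext i j
  simp only [Matrix.add_apply, Matrix.smul_apply, Matrix.neg_apply, Matrix.diagonal_apply, smul_eq_mul]
  split_ifs with h
  · subst h
    have hk : E - δ i = (E - e) + (e - δ i) := by have := hδ i; omega
    rw [hk, pow_add, inv_neg]
    ring
  · ring

omit [Fintype ρ] in
/-- Upper columns at small scales: `diag(σ⁻¹x^{E−δ}) + x^{E−e}C = −(x^{E−e}·(−C − diag((σ·x^{δ−e})⁻¹)))`
(`e < δ ≤ E`, `x ≠ 0`). [folklore] -/
theorem upperDual_eq_neg_smul_small (C : Matrix ρ ρ ℝ) (σ : ρ → ℝ) (E e : ℕ) (δ : ρ → ℕ) (hδ : ∀ j, e < δ j)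
    (hδE : ∀ j, δ j ≤ E) {x : ℝ} (hx : x ≠ 0) :
    Matrix.diagonal (fun j => (σ j)⁻¹ * x ^ (E - δ j)) + x ^ (E - e) • C
      = -(x ^ (E - e) • (-C - Matrix.diagonal (fun j => (σ j * x ^ (δ j - e))⁻¹))) := by
  ext i j
  simp only [Matrix.add_apply, Matrix.smul_apply, Matrix.neg_apply, Matrix.sub_apply, Matrix.diagonal_apply,
    smul_eq_mul]
  split_ifs with h
  · subst h
    have hk : E - e = (E - δ i) + (δ i - e) := by have := hδ i; have := hδE i; omega
    have hxp : x ^ (δ i - e) ≠ 0 := pow_ne_zero _ hx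
    rw [hk, pow_add, mul_inv]
    field_simp
    ring
  · ring

omit [Fintype ρₚ] [Fintype ρₙ] in
/-- **The dual at LARGE scales is `x^{E−e}·M(1/x)`** for the two-block family of `…TwoBlockDominance` with
`C₁₁ = C₊₊`, `C₁₂ = C₊₋`, `C₂₂ = C₋₋`, `α = σₚ⁻¹`, `p = δₚ − e`, `β = −σₙ`, `q = e − δₙ`. [folklore] -/
theorem dual_fromCols_eq_smul_large {B : Matrix ι ι ℝ} (hBs : B.IsSymm) (Uₚ : Matrix ι ρₚ ℝ) (Uₙ : Matrix ι ρₙ ℝ)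
    (σₚ : ρₚ → ℝ) (σₙ : ρₙ → ℝ) (E e : ℕ) (δₚ : ρₚ → ℕ) (δₙ : ρₙ → ℕ) (hδₚ : ∀ j, e < δₚ j)
    (hδₚE : ∀ j, δₚ j ≤ E) (hδₙ : ∀ j, δₙ j < e) (he : e ≤ E) {x : ℝ} (hx : 0 < x) :
    Matrix.diagonal (fun j => (Sum.elim σₚ σₙ j)⁻¹ * x ^ (E - Sum.elim δₚ δₙ j))
        + x ^ (E - e) • ((Matrix.fromCols Uₚ Uₙ)ᵀ * B⁻¹ * Matrix.fromCols Uₚ Uₙ)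
      = x ^ (E - e) • 𝕄[Uₚᵀ * B⁻¹ * Uₚ, Uₚᵀ * B⁻¹ * Uₙ, Uₙᵀ * B⁻¹ * Uₙ, (fun j => (σₚ j)⁻¹),
          (fun j => δₚ j - e), (fun j => -σₙ j), (fun j => e - δₙ j), x⁻¹] := by
  rw [eval_dual_fromCols B Uₚ Uₙ σₚ σₙ E e δₚ δₙ hBs x, Matrix.fromBlocks_smul, Matrix.fromBlocks_inj]
  refine ⟨?_, rfl, ?_, ?_⟩
  · rw [dual_eq_smul_rescaledDual _ σₚ E e δₚ hδₚ hδₚE hx.ne', add_comm]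
  · rw [Matrix.transpose_smul, transpose_gram_cross B Uₚ Uₙ hBs]
  · exact lowerDual_eq_smul_large _ σₙ E e δₙ hδₙ he x

omit [Fintype ρₚ] [Fintype ρₙ] in
/-- **The dual at SMALL scales, block-swapped, is `−x^{E−e}·M′(x)`** for the two-block family with
`C₁₁ = −C₋₋`, `C₁₂ = −C₋₊`, `C₂₂ = −C₊₊`, `α = (−σₙ)⁻¹`, `p = e − δₙ`, `β = σₚ`, `q = δₚ − e`. [folklore] -/
theorem dual_fromCols_swap_eq_neg_smul_small {B : Matrix ι ι ℝ} (hBs : B.IsSymm) (Uₚ : Matrix ι ρₚ ℝ)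
    (Uₙ : Matrix ι ρₙ ℝ) (σₚ : ρₚ → ℝ) (σₙ : ρₙ → ℝ) (E e : ℕ) (δₚ : ρₚ → ℕ) (δₙ : ρₙ → ℕ)
    (hδₚ : ∀ j, e < δₚ j) (hδₚE : ∀ j, δₚ j ≤ E) (hδₙ : ∀ j, δₙ j < e) (he : e ≤ E) {x : ℝ} (hx : 0 < x) :
    (Matrix.diagonal (fun j => (Sum.elim σₚ σₙ j)⁻¹ * x ^ (E - Sum.elim δₚ δₙ j))
        + x ^ (E - e) • ((Matrix.fromCols Uₚ Uₙ)ᵀ * B⁻¹ * Matrix.fromCols Uₚ Uₙ)).submatrix Sum.swap Sum.swap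
      = -(x ^ (E - e) • 𝕄[-(Uₙᵀ * B⁻¹ * Uₙ), -(Uₙᵀ * B⁻¹ * Uₚ), -(Uₚᵀ * B⁻¹ * Uₚ), (fun j => (-σₙ j)⁻¹),
          (fun j => e - δₙ j), σₚ, (fun j => δₚ j - e), x]) := by
  rw [eval_dual_fromCols B Uₚ Uₙ σₚ σₙ E e δₚ δₙ hBs x, Matrix.fromBlocks_submatrix_sum_swap_sum_swap,
    Matrix.fromBlocks_smul, Matrix.fromBlocks_neg, Matrix.fromBlocks_inj]
  refine ⟨?_, ?_, ?_, ?_⟩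
  · exact lowerDual_eq_neg_smul_small _ σₙ E e δₙ hδₙ he x
  · rw [Matrix.transpose_smul, transpose_gram_cross B Uₚ Uₙ hBs, smul_neg, neg_neg]
  · rw [Matrix.transpose_neg, transpose_gram_cross B Uₙ Uₚ hBs, smul_neg, neg_neg]
  · exact upperDual_eq_neg_smul_small _ σₚ E e δₚ hδₚ hδₚE hx.ne'

/-! ## §2  Transport of indices; end inertias of the dual -/

omit [DecidableEq ρ] in
/-- `A = c • M` with `c > 0` ⇒ `π(A) = π(M)`. [folklore] -/
theorem posIndex_eq_of_eq_smul [DecidableEq ρ] {A M : Matrix ρ ρ ℝ} (hA : A.IsHermitian) (hM : M.IsHermitian)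
    {c : ℝ} (hc : 0 < c) (h : A = c • M) :
    Fintype.card {j // 0 < hA.eigenvalues j} = Fintype.card {j // 0 < hM.eigenvalues j} := by
  have hcM : (c • M).IsHermitian := by rw [← h]; exact hA
  rw [Inertia.posIndex_congr hA hcM h, Inertia.posIndex_smul_pos hM hc hcM]

/-- `A` block-swapped equals `−(c • M)` with `c > 0` ⇒ `π(A) = ν(M)`. [folklore] -/
theorem posIndex_eq_negIndex_of_swap_eq_neg_smul {A : Matrix (ρₚ ⊕ ρₙ) (ρₚ ⊕ ρₙ) ℝ}
    {M : Matrix (ρₙ ⊕ ρₚ) (ρₙ ⊕ ρₚ) ℝ} (hA : A.IsHermitian) (hM : M.IsHermitian) {c : ℝ} (hc : 0 < c)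
    (h : A.submatrix Sum.swap Sum.swap = -(c • M)) :
    Fintype.card {j // 0 < hA.eigenvalues j} = Fintype.card {j // hM.eigenvalues j < 0} := by
  have hAs : (A.submatrix Sum.swap Sum.swap).IsHermitian := hA.submatrix _
  have hnAs : (-(A.submatrix Sum.swap Sum.swap)).IsHermitian := hAs.neg
  have hcM : (c • M).IsHermitian := by rw [← neg_neg (c • M), ← h]; exact hnAs
  rw [← posIndex_submatrix_swap hA hAs, ← negIndex_neg_eq_posIndex hAs hnAs, ← Inertia.negIndex_smul_pos hM hc hcM]
  exact (Inertia.negIndex_congr hcM hnAs (by rw [h, neg_neg])).symm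

omit [Fintype ι] [DecidableEq ι] [DecidableEq ρₚ] [DecidableEq ρₙ] in
/-- With positive signs on `ρₚ` and negative signs on `ρₙ`, `#{j : 0 < σⱼ} = |ρₚ|`. [folklore] -/
theorem card_pos_sumElim {σₚ : ρₚ → ℝ} {σₙ : ρₙ → ℝ} (hσₚ : ∀ j, 0 < σₚ j) (hσₙ : ∀ j, σₙ j < 0) :
    Fintype.card {j // 0 < Sum.elim σₚ σₙ j} = Fintype.card ρₚ := by
  classical
  rw [card_subtype_sum (fun j => 0 < Sum.elim σₚ σₙ j)]
  simp only [Sum.elim_inl, Sum.elim_inr]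
  rw [Fintype.card_subtype, Finset.filter_true_of_mem (fun j _ => hσₚ j), Finset.card_univ, Fintype.card_subtype,
    Finset.filter_false_of_mem (fun j _ => not_lt.2 (hσₙ j).le), Finset.card_empty, add_zero]

/-- **The dual at LARGE scales**: `π(𝔻(x)) + ν(C₊₊) = |ρₚ|` and `det 𝔻(x) ≠ 0` for all `x ≥ N`. [folklore] -/
theorem exists_posIndex_dual_large {B : Matrix ι ι ℝ} (hBs : B.IsSymm) (Uₚ : Matrix ι ρₚ ℝ) (Uₙ : Matrix ι ρₙ ℝ)
    {σₚ : ρₚ → ℝ} {σₙ : ρₙ → ℝ} (hσₚ : ∀ j, 0 < σₚ j) (hσₙ : ∀ j, σₙ j < 0) (E e : ℕ) {δₚ : ρₚ → ℕ}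
    {δₙ : ρₙ → ℕ} (hδₚ : ∀ j, e < δₚ j) (hδₚE : ∀ j, δₚ j ≤ E) (hδₙ : ∀ j, δₙ j < e) (he : e ≤ E)
    (hCₚ : (Uₚᵀ * B⁻¹ * Uₚ).IsHermitian) :
    ∃ N : ℝ, 0 < N ∧ ∀ x : ℝ, N ≤ x →
      Fintype.card {j // 0 < (isHermitian_eval_dual hBs (Matrix.fromCols Uₚ Uₙ) (Sum.elim σₚ σₙ) E e
            (Sum.elim δₚ δₙ) x).eigenvalues j} + Fintype.card {j // hCₚ.eigenvalues j < 0} = Fintype.card ρₚ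
        ∧ (Matrix.diagonal (fun j => (Sum.elim σₚ σₙ j)⁻¹ * x ^ (E - Sum.elim δₚ δₙ j))
            + x ^ (E - e) • ((Matrix.fromCols Uₚ Uₙ)ᵀ * B⁻¹ * Matrix.fromCols Uₚ Uₙ)).det ≠ 0 := by
  classical
  obtain ⟨ε, hε, hε'⟩ := Inertia.inertia_twoBlock (isSymm_gram hBs Uₚ) (isSymm_gram hBs Uₙ) (Uₚᵀ * B⁻¹ * Uₙ)
    (α := fun j => (σₚ j)⁻¹) (p := fun j => δₚ j - e) (β := fun j => -σₙ j) (q := fun j => e - δₙ j)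
    (fun j => inv_pos.2 (hσₚ j)) (fun j => neg_pos.2 (hσₙ j)) (fun j => by have := hδₚ j; omega)
    (fun j => by have := hδₙ j; omega) hCₚ
  refine ⟨ε⁻¹ + 1, by positivity, fun x hx => ?_⟩
  have hxpos : 0 < x := lt_of_lt_of_le (by positivity) hx
  have hxinv : x⁻¹ < ε := by
    calc x⁻¹ ≤ (ε⁻¹ + 1)⁻¹ := inv_anti₀ (by positivity) hx
      _ < (ε⁻¹)⁻¹ := inv_strictAnti₀ (by positivity) (lt_add_one _)
      _ = ε := inv_inv ε
  obtain ⟨-, hπ, hdet⟩ := hε' x⁻¹ (inv_pos.2 hxpos) hxinv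
  have heq := dual_fromCols_eq_smul_large hBs Uₚ Uₙ σₚ σₙ E e δₚ δₙ hδₚ hδₚE hδₙ he hxpos
  have hM := Inertia.isHermitian_twoBlock (isSymm_gram hBs Uₚ) (isSymm_gram hBs Uₙ) (Uₚᵀ * B⁻¹ * Uₙ)
    (fun j => (σₚ j)⁻¹) (fun j => δₚ j - e) (fun j => -σₙ j) (fun j => e - δₙ j) x⁻¹
  refine ⟨?_, ?_⟩
  · rw [posIndex_eq_of_eq_smul (isHermitian_eval_dual hBs _ _ E e _ x) hM (pow_pos hxpos _) heq]
    exact hπ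
  · rw [heq, Matrix.det_smul]
    exact mul_ne_zero (pow_ne_zero _ (pow_ne_zero _ hxpos.ne')) hdet

/-- **The dual at SMALL scales**: `π(𝔻(x)) = |ρₚ| + π(C₋₋)` and `det 𝔻(x) ≠ 0` for all `x ∈ (0, ε)`. [folklore] -/
theorem exists_posIndex_dual_small {B : Matrix ι ι ℝ} (hBs : B.IsSymm) (Uₚ : Matrix ι ρₚ ℝ) (Uₙ : Matrix ι ρₙ ℝ)
    {σₚ : ρₚ → ℝ} {σₙ : ρₙ → ℝ} (hσₚ : ∀ j, 0 < σₚ j) (hσₙ : ∀ j, σₙ j < 0) (E e : ℕ) {δₚ : ρₚ → ℕ}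
    {δₙ : ρₙ → ℕ} (hδₚ : ∀ j, e < δₚ j) (hδₚE : ∀ j, δₚ j ≤ E) (hδₙ : ∀ j, δₙ j < e) (he : e ≤ E)
    (hCₙ : (Uₙᵀ * B⁻¹ * Uₙ).IsHermitian) :
    ∃ ε : ℝ, 0 < ε ∧ ∀ x : ℝ, 0 < x → x < ε →
      Fintype.card {j // 0 < (isHermitian_eval_dual hBs (Matrix.fromCols Uₚ Uₙ) (Sum.elim σₚ σₙ) E e
            (Sum.elim δₚ δₙ) x).eigenvalues j} = Fintype.card ρₚ + Fintype.card {j // 0 < hCₙ.eigenvalues j}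
        ∧ (Matrix.diagonal (fun j => (Sum.elim σₚ σₙ j)⁻¹ * x ^ (E - Sum.elim δₚ δₙ j))
            + x ^ (E - e) • ((Matrix.fromCols Uₚ Uₙ)ᵀ * B⁻¹ * Matrix.fromCols Uₚ Uₙ)).det ≠ 0 := by
  classical
  have hnCₙ : (-(Uₙᵀ * B⁻¹ * Uₙ)).IsHermitian := hCₙ.neg
  obtain ⟨ε, hε, hε'⟩ := Inertia.inertia_twoBlock (isSymm_gram hBs Uₙ).neg (isSymm_gram hBs Uₚ).neg
    (-(Uₙᵀ * B⁻¹ * Uₚ)) (α := fun j => (-σₙ j)⁻¹) (p := fun j => e - δₙ j) (β := σₚ) (q := fun j => δₚ j - e)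
    (fun j => inv_pos.2 (neg_pos.2 (hσₙ j))) hσₚ (fun j => by have := hδₙ j; omega)
    (fun j => by have := hδₚ j; omega) hnCₙ
  refine ⟨ε, hε, fun x hx hxε => ?_⟩
  obtain ⟨hν, -, hdet⟩ := hε' x hx hxε
  have heq := dual_fromCols_swap_eq_neg_smul_small hBs Uₚ Uₙ σₚ σₙ E e δₚ δₙ hδₚ hδₚE hδₙ he hx
  have hM := Inertia.isHermitian_twoBlock (isSymm_gram hBs Uₙ).neg (isSymm_gram hBs Uₚ).neg (-(Uₙᵀ * B⁻¹ * Uₚ))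
    (fun j => (-σₙ j)⁻¹) (fun j => e - δₙ j) σₚ (fun j => δₚ j - e) x
  refine ⟨?_, ?_⟩
  · rw [posIndex_eq_negIndex_of_swap_eq_neg_smul (isHermitian_eval_dual hBs _ _ E e _ x) hM (pow_pos hx _) heq, hν,
      negIndex_neg_eq_posIndex hCₙ hnCₙ]
  · intro h0
    apply hdet
    have h1 := Matrix.det_submatrix_equiv_self (Equiv.sumComm ρₙ ρₚ)
      (Matrix.diagonal (fun j => (Sum.elim σₚ σₙ j)⁻¹ * x ^ (E - Sum.elim δₚ δₙ j))
        + x ^ (E - e) • ((Matrix.fromCols Uₚ Uₙ)ᵀ * B⁻¹ * Matrix.fromCols Uₚ Uₙ))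
    rw [h0] at h1
    have h2 : ((Matrix.diagonal (fun j => (Sum.elim σₚ σₙ j)⁻¹ * x ^ (E - Sum.elim δₚ δₙ j))
        + x ^ (E - e) • ((Matrix.fromCols Uₚ Uₙ)ᵀ * B⁻¹ * Matrix.fromCols Uₚ Uₙ)).submatrix Sum.swap Sum.swap).det = 0 :=
      h1
    rw [heq, Matrix.det_neg, Matrix.det_smul] at h2
    have hc : (-1 : ℝ) ^ Fintype.card (ρₙ ⊕ ρₚ) * (x ^ (E - e)) ^ Fintype.card (ρₙ ⊕ ρₚ) ≠ 0 :=
      mul_ne_zero (pow_ne_zero _ (by norm_num)) (pow_ne_zero _ (pow_ne_zero _ hx.ne'))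
    rw [← mul_assoc] at h2
    exact (mul_eq_zero.1 h2).resolve_left hc

/-! ## §3  End inertias of the word -/

/-- **The word at LARGE scales**: `ν(F(x)) + ν(C₊₊) = ν(B)` and `det F(x) ≠ 0` for `x ≥ N`. [folklore] -/
theorem exists_negIndex_word_large {B : Matrix ι ι ℝ} (hBs : B.IsSymm) (hBu : IsUnit B.det) (Uₚ : Matrix ι ρₚ ℝ)
    (Uₙ : Matrix ι ρₙ ℝ) {σₚ : ρₚ → ℝ} {σₙ : ρₙ → ℝ} (hσₚ : ∀ j, 0 < σₚ j) (hσₙ : ∀ j, σₙ j < 0) (e : ℕ)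
    {δₚ : ρₚ → ℕ} {δₙ : ρₙ → ℕ} (hδₚ : ∀ j, e < δₚ j) (hδₙ : ∀ j, δₙ j < e) (hB : B.IsHermitian)
    (hCₚ : (Uₚᵀ * B⁻¹ * Uₚ).IsHermitian) :
    ∃ N : ℝ, 0 < N ∧ ∀ x : ℝ, N ≤ x →
      Fintype.card {j // (isHermitian_eval_word hBs (Matrix.fromCols Uₚ Uₙ) (Sum.elim σₚ σₙ) e
            (Sum.elim δₚ δₙ) x).eigenvalues j < 0} + Fintype.card {j // hCₚ.eigenvalues j < 0}
          = Fintype.card {j // hB.eigenvalues j < 0}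
        ∧ (x ^ e • B + Matrix.fromCols Uₚ Uₙ
            * Matrix.diagonal (fun j => Sum.elim σₚ σₙ j * x ^ (Sum.elim δₚ δₙ j)) * (Matrix.fromCols Uₚ Uₙ)ᵀ).det
              ≠ 0 := by
  classical
  obtain ⟨E, he, hδE⟩ := exists_bound e (Sum.elim δₚ δₙ)
  have hδₚE : ∀ j, δₚ j ≤ E := fun j => hδE (Sum.inl j)
  obtain ⟨N, hN, hN'⟩ := exists_posIndex_dual_large hBs Uₚ Uₙ hσₚ hσₙ E e hδₚ hδₚE hδₙ he hCₚ
  refine ⟨N, hN, fun x hx => ?_⟩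
  have hxpos : 0 < x := lt_of_lt_of_le hN hx
  obtain ⟨hπ, hdet⟩ := hN' x hx
  have hσ : ∀ j, Sum.elim σₚ σₙ j ≠ 0 := fun j => by
    cases j with
    | inl j => exact (hσₚ j).ne'
    | inr j => exact (hσₙ j).ne
  have hF := isHermitian_eval_word hBs (Matrix.fromCols Uₚ Uₙ) (Sum.elim σₚ σₙ) e (Sum.elim δₚ δₙ) x
  have hD := isHermitian_eval_dual hBs (Matrix.fromCols Uₚ Uₙ) (Sum.elim σₚ σₙ) E e (Sum.elim δₚ δₙ) x
  have hdual := negIndex_word_add_eq hBs hBu (Matrix.fromCols Uₚ Uₙ) (Sum.elim σₚ σₙ) hσ e E (Sum.elim δₚ δₙ)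
    he hδE hxpos hB hF hD
  rw [card_pos_sumElim hσₚ hσₙ] at hdual
  refine ⟨by omega, fun hF0 => ?_⟩
  have h := det_base_mul_eq B hBu (Matrix.fromCols Uₚ Uₙ) (Sum.elim σₚ σₙ) hσ e E (Sum.elim δₚ δₙ) he hδE
    hxpos.ne'
  rw [hF0, mul_zero] at h
  exact mul_ne_zero (mul_ne_zero (mul_ne_zero hBu.ne_zero (Finset.prod_ne_zero_iff.2 fun j _ => hσ j))
    (pow_ne_zero _ hxpos.ne')) hdet h.symm

/-- **The word at SMALL scales**: `ν(F(x)) = ν(B) + π(C₋₋)` and `det F(x) ≠ 0` for `x ∈ (0, ε)`. [folklore] -/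
theorem exists_negIndex_word_small {B : Matrix ι ι ℝ} (hBs : B.IsSymm) (hBu : IsUnit B.det) (Uₚ : Matrix ι ρₚ ℝ)
    (Uₙ : Matrix ι ρₙ ℝ) {σₚ : ρₚ → ℝ} {σₙ : ρₙ → ℝ} (hσₚ : ∀ j, 0 < σₚ j) (hσₙ : ∀ j, σₙ j < 0) (e : ℕ)
    {δₚ : ρₚ → ℕ} {δₙ : ρₙ → ℕ} (hδₚ : ∀ j, e < δₚ j) (hδₙ : ∀ j, δₙ j < e) (hB : B.IsHermitian)
    (hCₙ : (Uₙᵀ * B⁻¹ * Uₙ).IsHermitian) :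
    ∃ ε : ℝ, 0 < ε ∧ ∀ x : ℝ, 0 < x → x < ε →
      Fintype.card {j // (isHermitian_eval_word hBs (Matrix.fromCols Uₚ Uₙ) (Sum.elim σₚ σₙ) e
            (Sum.elim δₚ δₙ) x).eigenvalues j < 0}
          = Fintype.card {j // hB.eigenvalues j < 0} + Fintype.card {j // 0 < hCₙ.eigenvalues j}
        ∧ (x ^ e • B + Matrix.fromCols Uₚ Uₙ
            * Matrix.diagonal (fun j => Sum.elim σₚ σₙ j * x ^ (Sum.elim δₚ δₙ j)) * (Matrix.fromCols Uₚ Uₙ)ᵀ).det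
              ≠ 0 := by
  classical
  obtain ⟨E, he, hδE⟩ := exists_bound e (Sum.elim δₚ δₙ)
  have hδₚE : ∀ j, δₚ j ≤ E := fun j => hδE (Sum.inl j)
  obtain ⟨ε, hε, hε'⟩ := exists_posIndex_dual_small hBs Uₚ Uₙ hσₚ hσₙ E e hδₚ hδₚE hδₙ he hCₙ
  refine ⟨ε, hε, fun x hx hxε => ?_⟩
  obtain ⟨hπ, hdet⟩ := hε' x hx hxε
  have hσ : ∀ j, Sum.elim σₚ σₙ j ≠ 0 := fun j => by
    cases j with
    | inl j => exact (hσₚ j).ne'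
    | inr j => exact (hσₙ j).ne
  have hF := isHermitian_eval_word hBs (Matrix.fromCols Uₚ Uₙ) (Sum.elim σₚ σₙ) e (Sum.elim δₚ δₙ) x
  have hD := isHermitian_eval_dual hBs (Matrix.fromCols Uₚ Uₙ) (Sum.elim σₚ σₙ) E e (Sum.elim δₚ δₙ) x
  have hdual := negIndex_word_add_eq hBs hBu (Matrix.fromCols Uₚ Uₙ) (Sum.elim σₚ σₙ) hσ e E (Sum.elim δₚ δₙ)
    he hδE hx hB hF hD
  rw [card_pos_sumElim hσₚ hσₙ] at hdual
  refine ⟨by omega, fun hF0 => ?_⟩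
  have h := det_base_mul_eq B hBu (Matrix.fromCols Uₚ Uₙ) (Sum.elim σₚ σₙ) hσ e E (Sum.elim δₚ δₙ) he hδE hx.ne'
  rw [hF0, mul_zero] at h
  exact mul_ne_zero (mul_ne_zero (mul_ne_zero hBu.ne_zero (Finset.prod_ne_zero_iff.2 fun j _ => hσ j))
    (pow_ne_zero _ hx.ne')) hdet h.symm

end MonotoneExact

end GramDual

end Summit.ValiantsHypothesis.ValiantsHypothesis.Theorems.LacunarySymmetroidMatrixDescartes
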